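import Literature.AlgebraicGeometry.Hyperkaehler.K3HilbertType
import Literature.AlgebraicGeometry.Hyperkaehler.BeauvilleBogomolovForm
import Literature.AlgebraicGeometry.HodgeTheory.ComplexGysinCorrespondence
import Literature.AlgebraicGeometry.HodgeTheory.RationalHodgeClasses
import HarnessLib

/-!
# Markman's theorem: rational Hodge isometries of `H²` between projective `K3^[n]`-type manifolds are algebraic — NAMED FACT

Layer `Literature/AlgebraicGeometry/Hyperkaehler`. E. Markman, *Rational Hodge isometries of
hyper-Kähler varieties of `K3^[n]` type are algebraic*, Compos. Math. 160 (2024) (arXiv:2204.00516),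
Theorem 1.1 (§1.1, PDF p. 3, READ): "Let `X` and `Y` be IHSMs of `K3^[n]`-type and
`f : H²(X, ℚ) → H²(Y, ℚ)` a Hodge isometry. Theorem 1.1. There exists an analytic correspondence
`f̃ : H^*(X, ℚ) → H^*(Y, ℚ)`, which is an isometry with respect to the Mukai pairings and […] In
particular, `f` is algebraic whenever `X` and `Y` are projective." (Abstract, p. 2: "Let
`f : H²(X, ℚ) → H²(Y, ℚ)` be a rational Hodge isometry with respect to the Beauville–Bogomolov–Fujiki
pairings. We prove that `f` is induced by an analytic correspondence. […] When `X` and `Y` are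
projective the correspondences `f` and `f̃` are algebraic.") The case `n = 1` is Buskin's theorem
(`Surfaces.Buskin2019_hodgeIsometry_algebraic`); this file records the PROJECTIVE statement about `f`
alone (the last sentence of Thm. 1.1), which is what the Hodge routes `HodgeConjecture/NikulinTwinTransport`
(cruxes `TwinSimilitudeAlgebraic` stmt-HodgeConjecture-13674 — line `hyperkaehler-nikulin-anchors`,
fact F3 of `Cruxes/TwinSimilitudeAlgebraic/Lines/hyperkaehler-nikulin-anchors-heart.md` —,
`TwinTwistorTransport` 14393 — line `mukai-lift-full-similitude` —, `TwinTransportRMPicardTwo` 15067)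
consume.

## Rendering (tree carriers) and design

* `K3^[n]`-type: `Hyperkaehler.IsOfK3HilbertType n X` (file `K3HilbertType`: deformation equivalent
  to a smooth projective Hilbert scheme of `n` points of a K3 surface); PROJECTIVE (and smooth, which
  `IsOfK3HilbertType` deliberately does not assert): `Motives.IsSmoothProjective (2 * n) X`.  `2 ≤ n`
  (for `n = 1` the BBF clause below degenerates to the cup form only through Fujiki; the K3 case is
  Buskin's fact, kept separate).
* "Hodge isometry `f : H²(X, ℚ) → H²(Y, ℚ)`": a `ℂ`-linear `f : H²(X(ℂ); ℂ) → H²(Y(ℂ); ℂ)` (the tree's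
  carriers are complex; `f_ℚ ⊗ ℂ`) which (i) maps rational classes to rational classes
  (`HodgeTheory.IsRationalClass`), (ii) maps classes of Hodge type `(i, j)` to classes of type `(i, j)`
  (`HodgeTheory.IsOfHodgeType (2 * n) X 2 i j`, the `∃`-over-Hodge-models predicate of the routes),
  (iii) is bijective (an ISOMORPHISM of rational Hodge structures: with (i) and finite equal dimension
  the inverse is rational, with (ii) type-preserving), and (iv) is an ISOMETRY for the
  Beauville–Bogomolov–Fujiki forms.  For (iv) the tree has Beauville's cohomological quadratic form
  `beauvilleForm μ σ n hd` on `H²(·; ℂ)` (file `BeauvilleBogomolovForm`: Beauville 1983 §8 /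
  Huybrechts 1999 §1.9, for an orientation `μ` in real dimension `d = 4n` and a class `σ` with
  Beauville's normalisation `IsBeauvilleNormalised μ σ n hd`, `⟨σⁿ ⌣ σ̄ⁿ, [·]_μ⟩ = 1`, which forces `μ`
  to be the complex orientation).  For `σ` the class of the holomorphic symplectic form — here: a
  non-zero class of type `(2,0)` on `H²`, unique up to scalars on an IHSM (`h^{2,0} = 1`) — Beauville's
  `q_σ` is a POSITIVE REAL MULTIPLE `λ` of the primitive integral BBF form (Beauville Thm. 5 (a),
  Huybrechts §1.9 "The upshot"), and `λ` is CONSTANT on a deformation class (the BBF form is a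
  deformation invariant of `(H²(X, ℤ), ⌣, [X])` by Fujiki's relation `∫ β^{2n} = c_X · q(β)ⁿ`, Huybrechts
  §1.11, and `q_σ` varies continuously with the normalised `σ`), hence the SAME for `X` and `Y` of
  `K3^[n]`-type: so "`f` is an isometry for `q_{σ_X}`, `q_{σ_Y}`" (clause (iv) below, on the quadratic
  forms; the bilinear statement follows by polarisation) is exactly "`f` is a BBF isometry".  The
  clause is quantified over ALL orientation families `μ` and all normalised `(2,0)`-classes `σ_X, σ_Y`:
  for a `μ` whose orientation of `X(ℂ)` or `Y(ℂ)` is not the complex one no `σ` is normalised (module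
  docstring of `BeauvilleBogomolovForm`, (i)) and the statement is vacuous there — no junk theorem.
* "`f` is algebraic": `f` is the action `[Z]_* = pr_{Y*}(pr_X^* – ∪ Z)` of an ALGEBRAIC class
  `Z ∈ N^{2n} H^{4n}((Y ⊗ X)(ℂ); ℂ) = HodgeTheory.algebraicClasses (Y ⊗ X) (2 * n)` (a correspondence of
  degree `0` between `2n`-folds: `H²(X) → H^{2 + 4n - 4n}(Y)`), through the Gysin morphism of the
  orientation family `μ` (`HodgeTheory.corrAction μ hY hX`, file `ComplexGysinCorrespondence`; the
  `ℂ`-span convention of `algebraicClasses` absorbs the orientation unit and Markman's rational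
  coefficients, exactly as in the K3 routes and in `Buskin2019_hodgeIsometry_algebraic`).

## What is NOT here

The lift `f̃` to the full cohomology and the Mukai pairing (first part of Thm. 1.1); the non-projective
(analytic-correspondence) statement; the BBF form as a primitive integral form and markings of
`K3^[n]`-type manifolds (Beauville Thm. 5, Fujiki) — see "Not here" of `K3HilbertType`; any proof
(Markman's proof: Torelli for parallel-transport Hodge isometries, the groupoid `𝒢_an` of §1.2, BKR
and twisted sheaves — XL-apex).

## References

* [Markman2024] E. Markman, Rational Hodge isometries of hyper-Kähler varieties of K3^[n] type are
  algebraic, Compos. Math. 160 (2024), Thm. 1.1 (§1.1) and Abstract.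
* [Beauville1983] A. Beauville, Variétés kählériennes dont la première classe de Chern est nulle,
  J. Differential Geom. 18 (1983), §8 p. 772 and Thm. 5 (a); §9 Rem. 1.
* [Huybrechts1999] D. Huybrechts, Compact hyperkähler manifolds: basic results, Invent. Math. 135
  (1999), §1.9 and §1.11.
* [Buskin2019] N. Buskin, Every rational Hodge isometry between two K3 surfaces is algebraic,
  J. reine angew. Math. 755 (2019), Thm. 1.1 (the case n = 1).
-/

noncomputable section

open CategoryTheory MonoidalCategory

namespace Literature.AlgebraicGeometry.Hyperkaehler

/-- **Markman's theorem (Compos. Math. 2024, Thm. 1.1, projective case): every rational Hodge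
isometry `f : H²(X, ℚ) → H²(Y, ℚ)` between PROJECTIVE manifolds `X`, `Y` of `K3^[n]`-type (`n ≥ 2`)
is algebraic.**  Rendering (module docstring): for smooth projective `X, Y` of dimension `2n` of
`K3^[n]`-type (`IsOfK3HilbertType n`), an orientation family `μ`, non-zero `(2,0)`-classes
`σX ∈ H²(X(ℂ); ℂ)`, `σY ∈ H²(Y(ℂ); ℂ)` normalised à la Beauville (`⟨σⁿ ⌣ σ̄ⁿ, [·]_μ⟩ = 1`), and a
`ℂ`-linear bijection `f : H²(X(ℂ); ℂ) → H²(Y(ℂ); ℂ)` preserving rational classes and every Hodge type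
and ISOMETRIC for Beauville's quadratic forms `q_{σY} ∘ f = q_{σX}` (equivalently for the
Beauville–Bogomolov–Fujiki forms, of which these are the same positive multiple), there is an
algebraic class `Z ∈ N^{2n}H^{4n}((Y ⊗ X)(ℂ); ℂ)` with `f = [Z]_* = pr_{Y*}(pr_X^* – ∪ Z)`
(`HodgeTheory.corrAction μ`).  Verbatim source: "Let `X` and `Y` be IHSMs of `K3^[n]`-type and
`f : H²(X, ℚ) → H²(Y, ℚ)` a Hodge isometry. […] In particular, `f` is algebraic whenever `X` and `Y`
are projective."  The case `n = 1` is `Surfaces.Buskin2019_hodgeIsometry_algebraic`.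
[cite: Markman2024, Thm. 1.1 (§1.1) and Abstract] [cite: Huybrechts1999, §1.9 and §1.11]
[cite: Beauville1983, §8 p. 772 and Thm. 5 (a)] -/
def Markman2024_rationalHodgeIsometry_algebraic : Prop :=
  ∀ (n : ℕ), 2 ≤ n →
    ∀ (μ : HodgeTheory.OrientationFamily) (X Y : Motives.SchemeOver ℂ)
      (hX : Motives.IsSmoothProjective (2 * n) X) (hY : Motives.IsSmoothProjective (2 * n) Y),
      IsOfK3HilbertType n X → IsOfK3HilbertType n Y →
      ∀ (σX : HodgeTheory.complexBetti X 2) (σY : HodgeTheory.complexBetti Y 2),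
        HodgeTheory.IsOfHodgeType (2 * n) X 2 2 0 σX → σX ≠ 0 →
        IsBeauvilleNormalised (μ hX) σX n (by omega) →
        HodgeTheory.IsOfHodgeType (2 * n) Y 2 2 0 σY → σY ≠ 0 →
        IsBeauvilleNormalised (μ hY) σY n (by omega) →
        ∀ (f : HodgeTheory.complexBetti X 2 →ₗ[ℂ] HodgeTheory.complexBetti Y 2),
          Function.Bijective f →
          (∀ x, HodgeTheory.IsRationalClass x → HodgeTheory.IsRationalClass (f x)) →
          (∀ (i j : ℕ) x, HodgeTheory.IsOfHodgeType (2 * n) X 2 i j x →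
            HodgeTheory.IsOfHodgeType (2 * n) Y 2 i j (f x)) →
          (∀ x, beauvilleForm (μ hY) σY n (by omega) (f x) = beauvilleForm (μ hX) σX n (by omega) x) →
          ∃ Z ∈ HodgeTheory.algebraicClasses (Y ⊗ X) (2 * n),
            ∀ x : HodgeTheory.complexBetti X 2,
              f x = HodgeTheory.corrAction μ hY hX (rfl : 2 + 2 * (2 * n) = 2 + 2 * (2 * n)) Z x

end Literature.AlgebraicGeometry.Hyperkaehler

/-! ## Appended 2026-08-16 (prover seat prover-line-stmt-HodgeConjecture-13674-c1-0, line lead of crux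
stmt-HodgeConjecture-13674, fact F3 of `Cruxes/TwinSimilitudeAlgebraic/Lines/hyperkaehler_nikulin_anchors.lean`
reshape r2): Markman's Thm. 1.1 in MARKED form (`n = 2`)

The rendering above states the isometry clause with Beauville's normalised form `beauvilleForm (μ hX) σ n`,
whose normalisation `⟨σⁿσ̄ⁿ, [X]_μ⟩ = 1` is satisfiable only when `μ` orients `X(ℂ)` and `Y(ℂ)` complexly —
an orientation family the tree does not yet construct (`HodgeTheory/ComplexGysin`, "Not here").  The
routes that consume Markman's theorem (`NikulinTwinTransport`, cruxes 13674/14393/15067) work with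
LATTICE MARKINGS, exactly as the K3 case `Surfaces.Buskin2019_hodgeIsometry_algebraic` is rendered
marking-free through the cup form: below, "Hodge isometry for the BBF pairings" is read in
Beauville–Bogomolov MARKINGS `MarkedK3Sq[X, φ, P, z]` (integral marking `φ : H²(X(ℂ); ℂ) ≅ (Λ_{K3} ⊕ ⟨−2⟩) ⊗ ℂ`
with the Fujiki relation `a⁴ = 3 q(φa)² P`, which pins `q ∘ φ` to the BBF form — Beauville 1983 §9 Rem. 1,
Fujiki's constant `3` for `K3^{[2]}`), as `q(φ_Y f a, φ_Y f b) = q(φ_X a, φ_X b)`, and the conclusion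
`f = [Z]_*` is asserted for EVERY orientation family with Poincaré duality (different families change
`[Z]_*` by units, absorbed in the `ℂ`-span `algebraicClasses`), symbol for symbol as in Buskin's fact.
Special case `n = 2` (`K3^{[2]}`-type), the one the routes need.
-/

namespace Literature.AlgebraicGeometry.Hyperkaehler

open Literature.AlgebraicTopology.SingularHomology

/-- `MarkedK3Sq[X, φ, P, z]`: a BEAUVILLE–BOGOMOLOV MARKING of a smooth projective fourfold `X` of
`K3^{[2]}`-type with period `z ∈ (Λ_{K3} ⊕ ⟨−2⟩) ⊗ ℂ` (verbatim the clauses of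
`SymplecticInvolutionK3Square`): (m1) `P` is an integral generator of `H⁸(X(ℂ); ℂ)`; (m2) `φ`
identifies the integral classes of `H²(X(ℂ); ℂ)` with `ℤ²³`; (m3) Fujiki relation
`a⁴ = 3 · q(φ a)² · P`, `q = k3HilbertForm 2` (it pins `q ∘ φ` to the Beauville–Bogomolov form and `P`
to the complex orientation class); (m4) `φ⁻¹ z` spans the `(2,0)`-classes; (m5) the `(1,1)`-classes are
the `q`-orthogonal of `z` and `z̄`; (m6) `q(z) = 0 < q(z̄, z)`. Local notation only.
[cite: Beauville1983, §8 Thm. 5 and §9 Lemme 1, Rem. 1] [cite: Huybrechts1999, §1.9 and §1.11] -/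
local notation3 (prettyPrint := false) "MarkedK3Sq[" X ", " φ ", " P ", " z "]" =>
  ((HodgeTheory.IsIntegralClass P ∧
      ∀ Q : HodgeTheory.complexBetti X (2 * 4), HodgeTheory.IsIntegralClass Q → ∃ n : ℤ, Q = n • P) ∧
    (∀ c : HodgeTheory.complexBetti X 2,
        HodgeTheory.IsIntegralClass c ↔ ∃ v : K3HilbertIndex → ℤ, φ c = fun i => (v i : ℂ)) ∧
    (∀ a : HodgeTheory.complexBetti X 2,
        HodgeTheory.cupPowTwo a 4 = ((3 : ℂ) * (k3HilbertForm 2 (φ a) (φ a)) ^ 2) • P) ∧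
    (HodgeTheory.IsOfHodgeType 4 X 2 2 0 (LinearEquiv.symm φ z) ∧
      ∀ τ : HodgeTheory.complexBetti X 2, HodgeTheory.IsOfHodgeType 4 X 2 2 0 τ →
        ∃ t : ℂ, τ = t • LinearEquiv.symm φ z) ∧
    (∀ c : HodgeTheory.complexBetti X 2, HodgeTheory.IsOfHodgeType 4 X 2 1 1 c ↔
        (k3HilbertForm 2 (φ c) z = 0 ∧ k3HilbertForm 2 (φ c) (star z) = 0)) ∧
    (k3HilbertForm 2 z z = 0 ∧ 0 < (k3HilbertForm 2 (star z) z).re))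

/-- **F3 — MARKMAN'S THEOREM IN MARKED FORM (Compos. Math. 2024, Thm. 1.1, projective case, `n = 2`):
every rational Hodge isometry `f : H²(X, ℚ) → H²(Y, ℚ)` between projective manifolds of `K3^{[2]}`-type
is algebraic.**  "Let `X` and `Y` be IHSMs of `K3^{[n]}`-type and `f : H²(X, ℚ) → H²(Y, ℚ)` a Hodge
isometry [with respect to the Beauville–Bogomolov–Fujiki pairings] […] In particular, `f` is algebraic
whenever `X` and `Y` are projective."  Rendering parallel to `Surfaces.Buskin2019_hodgeIsometry_algebraic`
(the case `n = 1`): for smooth projective `X, Y` of `K3^{[2]}`-type with BBF-markings and a `ℂ`-linear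
bijection `f : H²(X(ℂ); ℂ) → H²(Y(ℂ); ℂ)` preserving rational classes and every Hodge type and
ISOMETRIC IN THE MARKINGS (`q(φ_Y f a, φ_Y f b) = q(φ_X a, φ_X b)`, `q = k3HilbertForm 2` — the BBF
pairings by the Fujiki clause of the markings), there is, for every orientation family with Poincaré
duality, an algebraic `Z ∈ N⁴H⁸((Y ⊗ X)(ℂ); ℂ)` with `f = [Z]_* = pr_{Y*}(pr_X^* – ∪ Z)`
(`HodgeTheory.corrAction`).  This is the orientation-free, marking-based companion of
`Markman2024_rationalHodgeIsometry_algebraic` above (same theorem rendered with Beauville's normalised form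
`beauvilleForm`, whose normalisation presupposes the complex orientation family).
-- TODO(general form): all `n ≥ 2` (`K3^{[n]}`-type, `Λ_{K3} ⊕ ⟨2 − 2n⟩`, Fujiki constant `(2n)!/(n! 2ⁿ)`).
[cite: Markman2024, Thm. 1.1 (§1.1) and Abstract] [cite: Beauville1983, §8 Thm. 5 and §9 Rem. 1] -/
def Markman2024_rationalHodgeIsometry_algebraic_marked : Prop :=
  ∀ (μ : HodgeTheory.OrientationFamily), μ.HasPoincareDuality →
    ∀ (X Y : Motives.SchemeOver ℂ) (hX : Motives.IsSmoothProjective 4 X)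
      (hY : Motives.IsSmoothProjective 4 Y), IsOfK3HilbertSquareType X → IsOfK3HilbertSquareType Y →
      ∀ (φX : HodgeTheory.complexBetti X 2 ≃ₗ[ℂ] (K3HilbertIndex → ℂ))
        (PX : HodgeTheory.complexBetti X (2 * 4)) (zX : K3HilbertIndex → ℂ)
        (φY : HodgeTheory.complexBetti Y 2 ≃ₗ[ℂ] (K3HilbertIndex → ℂ))
        (PY : HodgeTheory.complexBetti Y (2 * 4)) (zY : K3HilbertIndex → ℂ),
        MarkedK3Sq[X, φX, PX, zX] → MarkedK3Sq[Y, φY, PY, zY] →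
        ∀ (f : HodgeTheory.complexBetti X 2 →ₗ[ℂ] HodgeTheory.complexBetti Y 2),
          Function.Bijective f →
          (∀ x, HodgeTheory.IsRationalClass x → HodgeTheory.IsRationalClass (f x)) →
          (∀ (i j : ℕ) x, HodgeTheory.IsOfHodgeType 4 X 2 i j x →
            HodgeTheory.IsOfHodgeType 4 Y 2 i j (f x)) →
          (∀ a b, k3HilbertForm 2 (φY (f a)) (φY (f b)) = k3HilbertForm 2 (φX a) (φX b)) →
          ∃ Z ∈ HodgeTheory.algebraicClasses (Y ⊗ X) 4,
            ∀ x : HodgeTheory.complexBetti X 2,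
              f x = HodgeTheory.corrAction μ hY hX (rfl : 2 + 2 * 4 = 2 + 2 * 4) Z x

end Literature.AlgebraicGeometry.Hyperkaehler

end
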